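import Literature.NumberTheory.EllipticCurves.RationalIsogenyDegreesProofs
import HarnessLib

/-!
# Kenku's composite levels: the minimal excluded degrees of rational cyclic isogenies

Literature / elliptic curves. A FACT DECOMPOSITION (D-0014) of the tree's named fact
`Literature.NumberTheory.EllipticCurves.mazurKenku_exists_cyclic_isogeny` (Silverman *AEC* IX.6,
Example 6.4: a cyclic `ℚ`-isogeny between elliptic curves over `ℚ` has degree in
`kenkuDegrees = {1, …, 19} ∪ {21, 25, 27, 37, 43, 67, 163}`; Mazur 1978 for the prime degrees, Kenku
1982 and the works cited there for the composite ones). The proofs file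
`RationalIsogenyDegreesProofs` shows (`mazurKenku_iff_mazur_of_minimalLevels`,
`mazurKenku_exists_cyclic_isogeny_of_mazur_of_minimalLevels`) that, GRANTED Mazur's Theorem 1
(`mazur_isogeny_irreducible`, itself split into `Mazur1978.cor44_valuation_j_le_one` and
`Mazur1978.prop51_exponent_classes_of_additive` in `OpenImageMazurInputs`), what remains of
Example 6.4 is exactly the exclusion of the MINIMAL composite levels — composite degrees outside
Kenku's list all of whose proper divisors are in the list, which are the 84 numbers
`20, 22, 24, 26, …, 10921, 26569 = 163²` (`mem_minimalLevels_of_minimal`), i.e. `Y₀(N)(ℚ) = ∅` for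
these `N`. That residual statement was so far only a hypothesis schema (`hL`) of those theorems; this
file records it as the named fact `kenku_minimalLevels_mem_kenkuDegrees`, verbatim in the consumed
shape, and PROVES from it:

* `isCyclic_degree_not_mem_minimalLevels_of_kenku` — no cyclic `ℚ`-isogeny of an elliptic curve over
  `ℚ` has degree among the 84 minimal levels (finite bookkeeping over the tree's
  `mem_kenkuDegrees_of_dvd_of_mem_minimalLevels`, `not_mem_kenkuDegrees_of_mem_minimalLevels`);
* `isCyclic_degree_mem_kenkuDegrees_of_mazur_of_kenku`, `mazurKenku_exists_cyclic_isogeny_of_mazur_of_kenku`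
  — Example 6.4 as printed, and the parent fact, from Mazur's Theorem 1 and this fact (one-liners over
  the tree's glue).

So the parent fact's trust base becomes {Cor. 4.4, Prop. 5.1-classes, this}. In print the 84
exclusions are: the genus-one levels `20, 24, 32, 36, 49, …` (Ligozat 1975; Kubert 1976), `26, 35,
39, 50, 65, 91, 125, 169` and the levels containing `11, 17, 19, 37, 43, 67, 163` (Mazur 1978 p. 129
table with Mazur–Vélu, Mazur–Swinnerton-Dyer; Kenku 1979–1981; Momose), as assembled by Kenku 1982,
whose Theorem 1 (at most eight `ℚ`-isomorphism classes in a `ℚ`-isogeny class) rests on exactly this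
list; Silverman *AEC* IX.6 Ex. 6.4 prints the resulting list. Not here: any of the 84 Diophantine
determinations (no modular curve `X₀(N)` over `ℚ` with its moduli interpretation in the tree).

## References

* J. H. Silverman, *The Arithmetic of Elliptic Curves*, 2nd ed., GTM 106 (2009): IX.6 Example 6.4.
  [SilvermanAEC2009]
* M. A. Kenku, *On the number of `ℚ`-isomorphism classes of elliptic curves in each `ℚ`-isogeny
  class*, J. Number Theory 15 (1982) 199–202: Thm. 1 and the list of levels in its proof. [Kenku1982]
* B. Mazur, *Rational isogenies of prime degree*, Invent. Math. 44 (1978): Thm. 1, table p. 129.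
  [Mazur1978]
* G. Ligozat, *Courbes modulaires de genre 1*, Mém. SMF 43 (1975). [Ligozat1975]
-/

noncomputable section

open scoped Classical

namespace Literature.NumberTheory.EllipticCurves

open _root_.WeierstrassCurve

/-- **Kenku's composite levels (the residual content of *AEC* IX.6 Example 6.4 beyond Mazur's
Theorem 1).** No cyclic `ℚ`-isogeny between elliptic curves over `ℚ` has a composite degree `N`
outside Kenku's list `{1, …, 19, 21, 25, 27, 37, 43, 67, 163}` all of whose proper divisors lie in the
list — rendered positively, verbatim as the hypothesis `hL` of the tree's
`mazurKenku_iff_mazur_of_minimalLevels`: for a cyclic `φ` of non-prime degree whose proper divisors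
are all in `kenkuDegrees`, `deg φ ∈ kenkuDegrees`. By `mem_minimalLevels_of_minimal` the excluded
`N` are exactly the 84 levels `20, 22, 24, 26, 28, 30, 32, …, 10921, 26569`, for which
`Y₀(N)(ℚ) = ∅` (Kenku 1982 and the determinations assembled there; the list is printed in Silverman,
*AEC*, IX.6 Example 6.4). [cite: SilvermanAEC2009, IX.6 Example 6.4] [cite: Kenku1982, Thm. 1 (proof, list of levels)] -/
def kenku_minimalLevels_mem_kenkuDegrees : Prop :=
  ∀ (W W' : WeierstrassCurve ℚ) [W.IsElliptic] [W'.IsElliptic] (φ : Isogeny W W'),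
    φ.IsCyclic → ¬ φ.degree.Prime → (∀ e, e ∣ φ.degree → e < φ.degree → e ∈ kenkuDegrees) →
      φ.degree ∈ kenkuDegrees

/-- None of the 84 minimal excluded levels is prime (a finite check).
[cite: SilvermanAEC2009, IX.6 Example 6.4] -/
theorem not_prime_of_mem_minimalLevels :
    ∀ d ∈ ({20, 22, 24, 26, 28, 30, 32, 33, 34, 35, 36, 38, 39, 42, 45, 49, 50, 51, 54, 55, 57,
        63, 65, 74, 75, 77, 81, 85, 86, 91, 95, 111, 119, 121, 125, 129, 133, 134, 143, 169, 185,
        187, 201, 209, 215, 221, 247, 259, 289, 301, 323, 326, 335, 361, 407, 469, 473, 481, 489,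
        559, 629, 703, 731, 737, 815, 817, 871, 1139, 1141, 1273, 1369, 1591, 1793, 1849, 2119,
        2479, 2771, 2881, 3097, 4489, 6031, 7009, 10921, 26569} : Finset ℕ),
      ¬ d.Prime := by
  decide +kernel

/-- **No cyclic `ℚ`-isogeny of an elliptic curve over `ℚ` has degree among the 84 minimal excluded
levels**, granted `kenku_minimalLevels_mem_kenkuDegrees`: such a level is composite
(`not_prime_of_mem_minimalLevels`), outside Kenku's list (`not_mem_kenkuDegrees_of_mem_minimalLevels`)
and all its proper divisors are in the list (`mem_kenkuDegrees_of_dvd_of_mem_minimalLevels`), so the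
fact would put it in the list. [cite: SilvermanAEC2009, IX.6 Example 6.4] [cite: Kenku1982, Thm. 1 (proof, list of levels)] -/
theorem isCyclic_degree_not_mem_minimalLevels_of_kenku (hK : kenku_minimalLevels_mem_kenkuDegrees)
    {W W' : WeierstrassCurve ℚ} [W.IsElliptic] [W'.IsElliptic] (φ : Isogeny W W')
    (hφ : φ.IsCyclic) :
    φ.degree ∉ ({20, 22, 24, 26, 28, 30, 32, 33, 34, 35, 36, 38, 39, 42, 45, 49, 50, 51, 54, 55, 57,
        63, 65, 74, 75, 77, 81, 85, 86, 91, 95, 111, 119, 121, 125, 129, 133, 134, 143, 169, 185,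
        187, 201, 209, 215, 221, 247, 259, 289, 301, 323, 326, 335, 361, 407, 469, 473, 481, 489,
        559, 629, 703, 731, 737, 815, 817, 871, 1139, 1141, 1273, 1369, 1591, 1793, 1849, 2119,
        2479, 2771, 2881, 3097, 4489, 6031, 7009, 10921, 26569} : Finset ℕ) := fun hmem ↦
  not_mem_kenkuDegrees_of_mem_minimalLevels _ hmem
    (hK W W' φ hφ (not_prime_of_mem_minimalLevels _ hmem)
      (fun _ he hlt ↦ mem_kenkuDegrees_of_dvd_of_mem_minimalLevels hmem he hlt))

/-- **Example 6.4 as printed, from Mazur's Theorem 1 and Kenku's composite levels**: every cyclic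
`ℚ`-isogeny of an elliptic curve over `ℚ` has degree in `kenkuDegrees` (the tree's
`isCyclic_degree_mem_kenkuDegrees_of_mazur_of_minimalLevels` with its schema `hL` supplied by the
named fact). [cite: SilvermanAEC2009, IX.6 Example 6.4] [cite: Mazur1978, Thm 1] -/
theorem isCyclic_degree_mem_kenkuDegrees_of_mazur_of_kenku (hM : mazur_isogeny_irreducible)
    (hK : kenku_minimalLevels_mem_kenkuDegrees) {W W' : WeierstrassCurve ℚ} [W.IsElliptic]
    (φ : Isogeny W W') (hφ : φ.IsCyclic) : φ.degree ∈ kenkuDegrees :=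
  isCyclic_degree_mem_kenkuDegrees_of_mazur_of_minimalLevels hM hK φ hφ

/-- **The Mazur–Kenku fact from Mazur's Theorem 1 and Kenku's composite levels** (the tree's
`mazurKenku_exists_cyclic_isogeny_of_mazur_of_minimalLevels` with `hL` supplied by the named fact):
the trust base of `mazurKenku_exists_cyclic_isogeny` is thereby
{`Mazur1978.cor44_valuation_j_le_one`, `Mazur1978.prop51_exponent_classes_of_additive`,
`kenku_minimalLevels_mem_kenkuDegrees`} (`mazur_isogeny_irreducible_holds_of`).
[cite: SilvermanAEC2009, IX.6 Example 6.4] [cite: Mazur1978, Thm 1] [cite: Kenku1982, Thm. 1 (proof, list of levels)] -/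
theorem mazurKenku_exists_cyclic_isogeny_of_mazur_of_kenku (hM : mazur_isogeny_irreducible)
    (hK : kenku_minimalLevels_mem_kenkuDegrees) : mazurKenku_exists_cyclic_isogeny :=
  mazurKenku_exists_cyclic_isogeny_of_mazur_of_minimalLevels hM hK

end Literature.NumberTheory.EllipticCurves


/-! ## Appended 2026-08-16 (same seat): the decomposition is EXACT

`mazurKenku_exists_cyclic_isogeny ↔ mazur_isogeny_irreducible ∧ kenku_minimalLevels_mem_kenkuDegrees`
(`mazurKenku_iff_mazur_and_kenku`). The new ingredient is `degree_eq_of_isCyclic`: two CYCLIC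
`ℚ`-isogenies between the same pair of elliptic curves over `ℚ` have the same degree (dual isogeny,
`End_ℚ(E) = ℤ` by the tree's `not_hasRationalCM_holds`, kernel counting), so the parent fact — which
provides SOME cyclic isogeny of Kenku degree — controls the degree of EVERY cyclic isogeny. -/

namespace Literature.NumberTheory.EllipticCurves

open _root_.WeierstrassCurve

/-- **Degree bookkeeping for two isogenies between the same elliptic curves over `ℚ`.** For
`ℚ`-isogenies `φ, ψ : E → E'` with `φ` cyclic there is `n ≥ 1` with `deg ψ · deg φ = n²` and
`deg φ ∣ n`: the dual `ψ̂` of `ψ` (Silverman, *AEC*, III.6.1(a)) gives `ψ̂ ∘ φ ∈ End_ℚ(E) = ℤ`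
(`not_hasRationalCM_holds`), say `[n]`; counting kernels (`ψ̂, φ` onto, *AEC* II.2.3)
`deg ψ · deg φ = #ker ψ̂ · #ker φ = #E[n] = n²`, and the cyclic group `ker φ ≤ E[n]` has order
dividing the exponent `n`. [cite: SilvermanAEC2009, Thm. III.6.1(a) and Cor. III.6.4(b)] -/
theorem exists_degree_mul_degree_eq_sq {W W' : WeierstrassCurve ℚ} [W.IsElliptic] [W'.IsElliptic]
    (φ ψ : Isogeny W W') (hφ : φ.IsCyclic) :
    ∃ n : ℕ, ψ.degree * φ.degree = n ^ 2 ∧ φ.degree ∣ n := by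
  -- the dual `ψd` of `ψ`: `ψd (ψ P) = deg ψ • P`
  obtain ⟨ψd, hψd⟩ := ψ.exists_dual_of_isElliptic
  -- `χ = ψd ∘ φ ∈ End_ℚ(E) = ℤ`
  obtain ⟨n, hn⟩ :
      ∃ n : ℤ, @Eq (AddMonoid.End W.geomPoints) (ψd.comp φ).toAddMonoidHom n := by
    by_contra hne
    push Not at hne
    exact not_hasRationalCM_holds W ⟨_, (ψd.comp φ).toAddMonoidHom_mem_endRing, hne⟩
  have hχ : ∀ P, ψd (φ P) = n • P := fun P ↦ by
    have := DFunLike.congr_fun hn P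
    rw [AddMonoid.End.intCast_apply] at this
    exact this
  -- `#ker ψd = deg ψ`, from `ψd ∘ ψ = [deg ψ]`
  have hd0 : (ψ.degree : ℤ) ≠ 0 := by exact_mod_cast ψ.degree_pos.ne'
  have hkerd : (ψd.comp ψ).toAddMonoidHom.ker = geomTorsion W (ψ.degree : ℤ) := by
    ext P
    rw [AddMonoidHom.mem_ker, Isogeny.coe_toAddMonoidHom, Isogeny.comp_apply, hψd]
    rfl
  have hcardd : Nat.card ψd.toAddMonoidHom.ker = ψ.degree := by
    have e : Nat.card (ψd.comp ψ).toAddMonoidHom.ker =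
        Nat.card ψd.toAddMonoidHom.ker * ψ.degree :=
      AddMonoidHom.natCard_ker_comp_of_surjective ψd.toAddMonoidHom ψ.toAddMonoidHom ψ.surjective
    rw [hkerd, natCard_geomTorsion_int_eq_sq W hd0, Int.natAbs_natCast, sq] at e
    exact (Nat.eq_of_mul_eq_mul_right ψ.degree_pos e).symm
  -- `n ≠ 0`
  have h1 : Nat.card (ψd.comp φ).toAddMonoidHom.ker = Nat.card ψd.toAddMonoidHom.ker * φ.degree :=
    AddMonoidHom.natCard_ker_comp_of_surjective ψd.toAddMonoidHom φ.toAddMonoidHom φ.surjective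
  have hn0 : n ≠ 0 := by
    rintro rfl
    have hker0 : (ψd.comp φ).toAddMonoidHom.ker = ⊤ := by
      ext P
      simp only [AddMonoidHom.mem_ker, Isogeny.coe_toAddMonoidHom, Isogeny.comp_apply, hχ,
        zero_smul, AddSubgroup.mem_top]
    have := h1
    rw [hker0, AddSubgroup.card_top, Nat.card_eq_zero_of_infinite, hcardd] at this
    exact (mul_pos ψ.degree_pos φ.degree_pos).ne' this.symm
  -- `ker (ψd ∘ φ) = E[n]`, so `deg ψ · deg φ = n²`
  have hχker : (ψd.comp φ).toAddMonoidHom.ker = geomTorsion W n := by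
    ext P
    rw [AddMonoidHom.mem_ker, Isogeny.coe_toAddMonoidHom, Isogeny.comp_apply, hχ]
    rfl
  have key : ψ.degree * φ.degree = n.natAbs ^ 2 := by
    rw [← hcardd, ← h1, hχker, natCard_geomTorsion_int_eq_sq W hn0]
  refine ⟨n.natAbs, key, ?_⟩
  -- `deg φ ∣ |n|`: a generator of the cyclic group `ker φ ≤ E[n]` is killed by `|n|`
  haveI : IsAddCyclic φ.toAddMonoidHom.ker := hφ
  obtain ⟨g, hg⟩ := IsAddCyclic.exists_ofOrder_eq_natCard (α := φ.toAddMonoidHom.ker)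
  have hgker : (g : W.geomPoints) ∈ (ψd.comp φ).toAddMonoidHom.ker := by
    rw [AddMonoidHom.mem_ker, Isogeny.coe_toAddMonoidHom, Isogeny.comp_apply]
    have hg0 : φ (g : W.geomPoints) = 0 := (AddMonoidHom.mem_ker).mp g.2
    rw [hg0, map_zero]
  rw [hχker] at hgker
  have hng : n.natAbs • (g : W.geomPoints) = 0 := by
    have h : n • (g : W.geomPoints) = 0 := hgker
    rcases Int.natAbs_eq n with h' | h'
    · rw [h'] at h
      exact_mod_cast h
    · rw [h'] at h
      rw [neg_smul, neg_eq_zero] at h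
      exact_mod_cast h
  have hng' : n.natAbs • g = 0 := Subtype.ext (by exact_mod_cast hng)
  have hdvd : addOrderOf g ∣ n.natAbs := addOrderOf_dvd_of_nsmul_eq_zero hng'
  rw [hg] at hdvd
  exact hdvd

/-- **Two cyclic `ℚ`-isogenies between the same pair of elliptic curves over `ℚ` have the same
degree** (indeed `Hom_ℚ(E, E') ≅ ℤ`): with `exists_degree_mul_degree_eq_sq` both ways,
`deg ψ · deg φ = n² = m²`, `deg φ ∣ n`, `deg ψ ∣ m = n`, whence `deg φ = deg ψ = n`.
[cite: SilvermanAEC2009, Thm. III.6.1(a) and Cor. III.6.4(b)] -/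
theorem degree_eq_of_isCyclic {W W' : WeierstrassCurve ℚ} [W.IsElliptic] [W'.IsElliptic]
    (φ ψ : Isogeny W W') (hφ : φ.IsCyclic) (hψ : ψ.IsCyclic) : φ.degree = ψ.degree := by
  obtain ⟨n, hn, hφn⟩ := exists_degree_mul_degree_eq_sq φ ψ hφ
  obtain ⟨m, hm, hψm⟩ := exists_degree_mul_degree_eq_sq ψ φ hψ
  have hnm : n = m := by
    have : n ^ 2 = m ^ 2 := by rw [← hn, ← hm, mul_comm]
    exact Nat.pow_left_injective (by norm_num) this
  subst hnm
  obtain ⟨a, ha⟩ := hφn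
  obtain ⟨b, hb⟩ := hψm
  have hpos : 0 < ψ.degree * φ.degree := mul_pos ψ.degree_pos φ.degree_pos
  -- `ψ.degree * φ.degree = n² = (φ.degree * a) * (ψ.degree * b)` forces `a * b = 1`
  have hab : a * b = 1 := by
    have h : ψ.degree * φ.degree * (a * b) = ψ.degree * φ.degree * 1 := by
      calc ψ.degree * φ.degree * (a * b) = (φ.degree * a) * (ψ.degree * b) := by ring
        _ = n ^ 2 := by rw [← ha, ← hb, sq]
        _ = ψ.degree * φ.degree * 1 := by rw [hn, mul_one]
    exact Nat.eq_of_mul_eq_mul_left hpos h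
  have ha1 : a = 1 := Nat.eq_one_of_mul_eq_one_right hab
  have hb1 : b = 1 := Nat.eq_one_of_mul_eq_one_left hab
  rw [ha1, mul_one] at ha
  rw [hb1, mul_one] at hb
  rw [← ha, ← hb]

/-- **Every cyclic `ℚ`-isogeny has degree in Kenku's list, granted `mazurKenku_exists_cyclic_isogeny`**
(the fact supplies SOME cyclic isogeny of Kenku degree between the two curves; by
`degree_eq_of_isCyclic` the given one has the same degree). [cite: SilvermanAEC2009, IX.6 Example 6.4] -/
theorem isCyclic_degree_mem_kenkuDegrees_of_mazurKenku (h : mazurKenku_exists_cyclic_isogeny)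
    {W W' : WeierstrassCurve ℚ} [W.IsElliptic] [W'.IsElliptic] (φ : Isogeny W W')
    (hφ : φ.IsCyclic) : φ.degree ∈ kenkuDegrees := by
  obtain ⟨ψ, hψ, hψK⟩ := h W W' ⟨φ⟩
  rwa [degree_eq_of_isCyclic φ ψ hφ hψ]

/-- **The parent fact implies Kenku's composite-level fact** (so the decomposition
`mazurKenku_exists_cyclic_isogeny ↔ mazur_isogeny_irreducible ∧ kenku_minimalLevels_mem_kenkuDegrees`
is exact, `mazurKenku_iff_mazur_and_kenku`). [cite: SilvermanAEC2009, IX.6 Example 6.4] -/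
theorem kenku_minimalLevels_mem_kenkuDegrees_of_mazurKenku (h : mazurKenku_exists_cyclic_isogeny) :
    kenku_minimalLevels_mem_kenkuDegrees := fun _ _ _ _ φ hφ _ _ ↦
  isCyclic_degree_mem_kenkuDegrees_of_mazurKenku h φ hφ

/-- **Exact decomposition of the Mazur–Kenku fact**:
`mazurKenku_exists_cyclic_isogeny ↔ mazur_isogeny_irreducible ∧ kenku_minimalLevels_mem_kenkuDegrees`
(`→`: `mazur_isogeny_irreducible_of_mazurKenku` and `kenku_minimalLevels_mem_kenkuDegrees_of_mazurKenku`;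
`←`: `mazurKenku_exists_cyclic_isogeny_of_mazur_of_kenku`). [cite: SilvermanAEC2009, IX.6 Example 6.4]
[cite: Mazur1978, Thm 1] [cite: Kenku1982, Thm. 1 (proof, list of levels)] -/
theorem mazurKenku_iff_mazur_and_kenku :
    mazurKenku_exists_cyclic_isogeny ↔
      mazur_isogeny_irreducible ∧ kenku_minimalLevels_mem_kenkuDegrees :=
  ⟨fun h ↦ ⟨mazur_isogeny_irreducible_of_mazurKenku h,
      kenku_minimalLevels_mem_kenkuDegrees_of_mazurKenku h⟩,
    fun h ↦ mazurKenku_exists_cyclic_isogeny_of_mazur_of_kenku h.1 h.2⟩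

end Literature.NumberTheory.EllipticCurves

/-! ## Appended 2026-08-16: Kenku's glue, proved (Kenku 1982, proof of Thm. 1, pp. 200–201)

Kenku's Theorem 1 (`Y₀(N)(ℚ) = ∅` unless `N ≤ 10` or
`N ∈ {12, 13, 16, 18, 25, 11, 14, 15, 17, 19, 21, 27, 37, 43, 67, 163}`) is assembled (pp. 199–201)
from (K0) Mazur 1978, Thm. 1 (prime `N`); (K1) the seventeen composite levels "minimal of positive
genus" `14, 15, 20, 21, 24, 26, 27, 32, 35, 36, 39, 49, 50, 65, 91, 125, 169` (Ligozat, Ogg, Joly for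
genus one; Kubert for `35, 50`; Mazur–Vélu for `26`; Kenku 1979–81 for `39, 65, 91, 169, 125`), of
which exactly `B = {11, 14, 15, 17, 19, 21, 27, 37, 43, 67, 163}` (primes of positive genus included)
carry non-cuspidal rational points, with known `j`-invariants; and (K2) for `N ∈ B` and a prime `N'`
the exclusion of cyclic `N'N`-isogenies: (a) `N'` of positive genus, `N' ≠ N` — the `j`-tables are
disjoint; (b) `N' = N` — *two distinct rational cyclic `N`-subgroups on one curve*; (c)
`N' ∈ {2, 3, 5, 7, 13}` — Klein–Fricke's `j = R_{N'}(t)/t` against the `j`-tables, the three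
survivors `(2, 14), (3, 15), (3, 21)` being excluded as in (b). The tree's 84 minimal levels are the
13 empty levels of (K1) (`20, 24, 26, 32, 35, 36, 39, 49, 50, 65, 91, 125, 169`) and 71 products `N'N`.

What is PROVED here is the part of this argument that is Kenku's own and purely isogeny-theoretic:

* `kenku_minimalLevels_mem_kenkuDegrees_iff_forall_degree_ne` — the fact is *equivalent* to the
  exclusion of the 84 levels as degrees of cyclic `ℚ`-isogenies (bookkeeping over the tree's
  `mem_minimalLevels_of_minimal`);
* `WeierstrassCurve.Isogeny.exists_isCyclic_ker_ne_of_degree_eq_prime_sq_mul` — **Kenku's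
  two-subgroups lemma** (cases (b) and the end of (c)), over any field of characteristic `0`: a
  cyclic isogeny of degree `p²M` (`p` prime, `p ∤ M`) out of `E` yields an elliptic curve `E₁`,
  `p`-isogenous to `E`, with two cyclic isogenies of degree `pM` out of `E₁` having DISTINCT kernels;
* `isCyclic_degree_ne_prime_sq_mul_of_ker_unique` — hence the ten levels
  `121, 289, 361, 1369, 1849, 4489, 26569` (`p²`, `M = 1`) and `28 = 2²·7`, `45 = 3²·5`,
  `63 = 3²·7` are excluded GRANTED the uniqueness of the rational cyclic `pM`-subgroup
  (hypothesis schema `hU`: "the rational points of `Y₀(pM)` have pairwise distinct `j`-invariants,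
  none `0` or `1728`", Kenku p. 200, for `pM ∈ {11, 17, 19, 37, 43, 67, 163, 14, 15, 21}` — the
  content of the determinations of `X₀(pM)(ℚ)` cited there (Ligozat, Ogg, Joly; Mazur), not in the
  tree);
* `isCyclic_degree_ne_mul_of_jTable` — case (a): the 21 levels `ℓ₁ℓ₂` (distinct primes among
  `11, 17, 19, 37, 43, 67, 163`) are excluded GRANTED the `j`-tables of the rational `ℓ`-isogenies
  (hypothesis schema `hT` over the data `largePrimeIsogenyJTable`, the eleven printed
  `j`-invariants, Cremona §3.8 p. 82; the tables themselves — Ligozat, Mazur–Swinnerton-Dyer,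
  Mazur — are not in the tree).

Not proved here (no moduli interpretation of `X₀(N)` over `ℚ` in the tree): (K1), the `j`-tables,
Klein–Fricke, hence case (c) (40 levels) and the 13 direct levels. -/

universe u

namespace WeierstrassCurve

open Literature.NumberTheory.EllipticCurves

variable {K : Type u} [Field K] {W W' : WeierstrassCurve K}

/-- A cyclic subgroup of `E(K̄)` contains no full `E[ℓ]` (`ℓ` prime, `ℓ ≠ 0` in `K`): `E[ℓ]` has
`ℓ²` elements all killed by `ℓ`, so it is not cyclic. [folklore] -/
theorem not_geomTorsion_le_of_isAddCyclic [W.IsElliptic] (G : AddSubgroup W.geomPoints)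
    [IsAddCyclic G] {ℓ : ℕ} (hℓ : ℓ.Prime) (hℓK : (ℓ : K) ≠ 0) :
    ¬ geomTorsion W (ℓ : ℤ) ≤ G := by
  intro hle
  haveI : IsAddCyclic (geomTorsion W (ℓ : ℤ)) := AddSubgroup.isAddCyclic_of_le hle
  haveI : Finite (geomTorsion W (ℓ : ℤ)) := finite_geomTorsion_natCast W hℓ.ne_zero
  obtain ⟨x, hx⟩ := IsAddCyclic.exists_ofOrder_eq_natCard (α := geomTorsion W (ℓ : ℤ))
  rw [natCard_geomTorsion_eq_sq W hℓK] at hx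
  have hxℓ : addOrderOf x ∣ ℓ := by
    apply addOrderOf_dvd_of_nsmul_eq_zero
    apply Subtype.ext
    rw [AddSubmonoidClass.coe_nsmul, ZeroMemClass.coe_zero]
    exact AddSubgroup.torsionBy.nsmul_iff.mp x.2
  rw [hx] at hxℓ
  have h1 : ℓ ^ 2 ≤ ℓ := Nat.le_of_dvd hℓ.pos hxℓ
  have h2 := hℓ.two_le
  nlinarith

namespace Isogeny

/-- If `g : E → E₁` and `f : E₁ → E` are isogenies of elliptic curves over `K` with `f ∘ g = [n]`
on `E(K̄)` (`n ≠ 0` in `K`) and `#ker g = n`, then `#ker f = n`: `#ker (f ∘ g) = #ker f · #ker g`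
(`g` is onto) and `#E[n] = n²`. [folklore] -/
theorem natCard_ker_eq_of_comp_eq_nsmul [W.IsElliptic] {W₁ : WeierstrassCurve K} [W₁.IsElliptic]
    (g : Isogeny W W₁) (f : Isogeny W₁ W) {n : ℕ} (hnK : (n : K) ≠ 0)
    (hg : Nat.card g.toAddMonoidHom.ker = n) (hfg : ∀ P, f (g P) = n • P) :
    Nat.card f.toAddMonoidHom.ker = n := by
  have hn : n ≠ 0 := fun h ↦ hnK (by rw [h, Nat.cast_zero])
  have h1 : Nat.card (f.toAddMonoidHom.comp g.toAddMonoidHom).ker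
      = Nat.card f.toAddMonoidHom.ker * Nat.card g.toAddMonoidHom.ker :=
    AddMonoidHom.natCard_ker_comp_of_surjective _ _ g.surjective
  have h2 : (f.toAddMonoidHom.comp g.toAddMonoidHom).ker = geomTorsion W (n : ℤ) := by
    ext P
    rw [AddMonoidHom.mem_ker, AddMonoidHom.comp_apply, AddSubgroup.torsionBy.nsmul_iff]
    change f (g P) = 0 ↔ _
    rw [hfg]
  rw [h2, natCard_geomTorsion_eq_sq W hnK, hg, sq] at h1
  exact (Nat.eq_of_mul_eq_mul_right (Nat.pos_of_ne_zero hn) h1).symm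

/-- **Kenku's two rational cyclic subgroups** (Kenku 1982, proof of Thm. 1, p. 200 l. 10 from
below — the case `N' = N` — and p. 201 l. 14 — the cases `(N', N) = (2, 14), (3, 15), (3, 21)`):
let `φ : E → E'` be a cyclic isogeny over `K` (characteristic `0`, `E` elliptic) of degree
`p² M` with `p` prime, `p ∤ M`, and let `A = ker φ`, `A_d = A ∩ E[d]`. Then on the quotient
`E₁ = E/A_p` (an elliptic curve `p`-isogenous to `E` over `K`) the two subgroups `A/A_p` and
`(A_{pM} + E[p])/A_p` are DISTINCT `Γ_K`-stable cyclic subgroups of order `pM`: there are cyclic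
isogenies `ψ₁ : E₁ → E₂`, `ψ₂ : E₁ → E₃` over `K` of degree `pM` with `ker ψ₁ ≠ ker ψ₂`
("`(E/_{N'}A, A/_{N'}A)` and `(E/_{N'}A, (_{N}A + _{N'}E)/_{N'}A)` … represent two distinct points
of `Y₀(N)(ℚ)`"). Here `ψ₁` is the quotient of `E₁` by `g(A)` and `ψ₂ = ψ_M ∘ ĝ` with
`ψ_M : E → E/A_M` (the tree's `exists_isCyclic_degree_eq_of_dvd`) and `ĝ` the dual of
`g : E → E₁`; `ker ψ₂ = ĝ⁻¹(A_M)` is cyclic because it contains no `E₁[ℓ]` (for `ℓ = p` by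
`p² ∤ pM`, for `ℓ ≠ p` because `ĝ` embeds `E₁[ℓ]` into the cyclic `A`), and `ker ψ₁ = ker ψ₂`
would force `E[p] ⊆ A`. [cite: Kenku1982, proof of Thm. 1, pp. 200–201] -/
theorem exists_isCyclic_ker_ne_of_degree_eq_prime_sq_mul [CharZero K] [W.IsElliptic]
    (φ : Isogeny W W') (hφ : φ.IsCyclic) {p M : ℕ} (hp : p.Prime) (hpM : ¬ p ∣ M)
    (hdeg : φ.degree = p ^ 2 * M) :
    ∃ (W₁ W₂ W₃ : WeierstrassCurve K) (_ : W₁.IsElliptic) (_ : W₂.IsElliptic) (_ : W₃.IsElliptic)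
      (g : Isogeny W W₁) (ψ₁ : Isogeny W₁ W₂) (ψ₂ : Isogeny W₁ W₃),
      g.degree = p ∧ ψ₁.IsCyclic ∧ ψ₂.IsCyclic ∧ ψ₁.degree = p * M ∧ ψ₂.degree = p * M ∧
        ψ₁.toAddMonoidHom.ker ≠ ψ₂.toAddMonoidHom.ker := by
  set A := φ.toAddMonoidHom.ker with hA_def
  haveI hAcyc : IsAddCyclic A := hφ
  have hpK : (p : K) ≠ 0 := Nat.cast_ne_zero.mpr hp.ne_zero
  -- `A_p = A ⊓ E[p]`: order `p`, finite, `Γ_K`-stable; the quotient `g : E → E₁ = E/A_p`, dual `f`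
  have hp_dvd : p ∣ φ.degree := hdeg ▸ Dvd.intro (p * M) (by ring)
  have hAp_card : Nat.card ↥(A ⊓ geomTorsion W (p : ℤ)) = p :=
    φ.natCard_ker_inf_geomTorsion_of_isCyclic hφ hp_dvd
  have hAp_fin : ((A ⊓ geomTorsion W (p : ℤ) : AddSubgroup W.geomPoints) : Set W.geomPoints).Finite :=
    φ.finite_ker.subset fun P hP ↦ (AddSubgroup.mem_inf.mp hP).1
  obtain ⟨W₁, hW₁, g, f, hker_g, hfg, -⟩ :=
    W.exists_isogeny_ker_eq_and_comp_eq_nsmul_holds (A ⊓ geomTorsion W (p : ℤ)) hAp_fin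
      (fun σ P hP ↦ φ.smul_mem_ker_inf_geomTorsion (p : ℤ) σ hP)
  rw [hAp_card] at hfg
  haveI := hW₁
  have hg_card : Nat.card g.toAddMonoidHom.ker = p := by rw [hker_g]; exact hAp_card
  have hf_card : Nat.card f.toAddMonoidHom.ker = p :=
    natCard_ker_eq_of_comp_eq_nsmul g f hpK hg_card hfg
  have hker_g_le : g.toAddMonoidHom.ker ≤ A := hker_g ▸ inf_le_left
  -- `ψ_M : E → E₃ = E/A_M`, cyclic of degree `M`
  have hM_dvd : M ∣ φ.degree := hdeg ▸ Dvd.intro_left (p ^ 2) rfl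
  obtain ⟨W₃, hW₃, ψM, -, hψM_deg, hψM_ker⟩ := φ.exists_isCyclic_degree_eq_of_dvd hφ hM_dvd
  haveI := hW₃
  -- `ψ₂ = ψ_M ∘ f`
  have hψ₂_deg : (ψM.comp f).degree = p * M := by
    change Nat.card (ψM.toAddMonoidHom.comp f.toAddMonoidHom).ker = _
    rw [AddMonoidHom.natCard_ker_comp_of_surjective _ _ f.surjective, hf_card, mul_comm]
    exact congrArg (p * ·) hψM_deg
  -- `ψ₁ : E₁ → E₂ = E₁/g(A)`
  set C₁ := A.map g.toAddMonoidHom with hC₁_def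
  have hC₁_fin : (C₁ : Set W₁.geomPoints).Finite := by
    rw [hC₁_def, AddSubgroup.coe_map]
    exact φ.finite_ker.image _
  have hC₁_stab : ∀ (σ : Field.absoluteGaloisGroup K) (Q : W₁.geomPoints), Q ∈ C₁ → σ • Q ∈ C₁ := by
    intro σ Q hQ
    obtain ⟨P, hP, rfl⟩ := AddSubgroup.mem_map.mp hQ
    refine AddSubgroup.mem_map.mpr ⟨σ • P, ?_, ?_⟩
    · rw [AddMonoidHom.mem_ker] at hP ⊢
      change φ (σ • P) = 0
      rw [φ.map_smul, show φ P = 0 from hP, smul_zero]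
    · change g (σ • P) = σ • g P
      exact g.map_smul σ P
  obtain ⟨W₂, hW₂, ψ₁, hψ₁_ker⟩ :=
    exists_isogeny_ker_eq_of (exists_isogeny_ker_eq_and_comp_eq_nsmul_holds W₁) C₁ hC₁_fin hC₁_stab
  haveI := hW₂
  have hψ₁_cyc : ψ₁.IsCyclic := by
    change IsAddCyclic ψ₁.toAddMonoidHom.ker
    rw [hψ₁_ker]
    exact isAddCyclic_of_surjective _ (g.toAddMonoidHom.addSubgroupMap_surjective A)
  have hψ₁_deg : ψ₁.degree = p * M := by
    have h1 : Nat.card (ψ₁.toAddMonoidHom.comp g.toAddMonoidHom).ker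
        = Nat.card ψ₁.toAddMonoidHom.ker * Nat.card g.toAddMonoidHom.ker :=
      AddMonoidHom.natCard_ker_comp_of_surjective _ _ g.surjective
    have h2 : (ψ₁.toAddMonoidHom.comp g.toAddMonoidHom).ker = A := by
      rw [← AddMonoidHom.comap_ker, hψ₁_ker, hC₁_def, AddSubgroup.comap_map_eq_self hker_g_le]
    rw [h2, hg_card, hA_def] at h1
    change φ.degree = ψ₁.degree * p at h1
    rw [hdeg, sq, mul_assoc, mul_comm] at h1
    exact (Nat.eq_of_mul_eq_mul_right hp.pos h1).symm
  -- `ψ₂` is cyclic: its kernel `f⁻¹(A_M)` contains no `E₁[ℓ]`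
  have hψ₂_cyc : (ψM.comp f).IsCyclic := by
    change IsAddCyclic (ψM.comp f).toAddMonoidHom.ker
    refine isAddCyclic_of_forall_not_geomTorsion_le W₁ _ fun ℓ hℓ hle ↦ ?_
    haveI : Finite (geomTorsion W₁ (ℓ : ℤ)) := finite_geomTorsion_natCast W₁ hℓ.ne_zero
    have hℓK : (ℓ : K) ≠ 0 := Nat.cast_ne_zero.mpr hℓ.ne_zero
    have hℓcard : Nat.card (geomTorsion W₁ (ℓ : ℤ)) = ℓ ^ 2 := natCard_geomTorsion_eq_sq W₁ hℓK
    by_cases hℓp : ℓ = p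
    · subst hℓp
      have hdvd := AddSubgroup.card_dvd_of_le hle
      rw [hℓcard] at hdvd
      change ℓ ^ 2 ∣ (ψM.comp f).degree at hdvd
      rw [hψ₂_deg, sq] at hdvd
      exact hpM (Nat.dvd_of_mul_dvd_mul_left hℓ.pos hdvd)
    · -- `f` maps `E₁[ℓ]` injectively into `A ⊓ E[ℓ]`, of order `≤ ℓ`
      have hmem : ∀ T : geomTorsion W₁ (ℓ : ℤ),
          (f.toAddMonoidHom.comp (geomTorsion W₁ (ℓ : ℤ)).subtype) T ∈ A ⊓ geomTorsion W (ℓ : ℤ) := by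
        intro T
        have hT : (T : W₁.geomPoints) ∈ (ψM.comp f).toAddMonoidHom.ker := hle T.2
        rw [ker_comp, AddSubgroup.mem_comap, hψM_ker] at hT
        refine AddSubgroup.mem_inf.mpr ⟨(AddSubgroup.mem_inf.mp hT).1, ?_⟩
        rw [AddSubgroup.torsionBy.nsmul_iff, AddMonoidHom.comp_apply, ← map_nsmul]
        change f (ℓ • (T : W₁.geomPoints)) = 0
        rw [AddSubgroup.torsionBy.nsmul_iff.mp T.2, map_zero]
      set r : geomTorsion W₁ (ℓ : ℤ) →+ ↥(A ⊓ geomTorsion W (ℓ : ℤ)) :=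
        (f.toAddMonoidHom.comp (geomTorsion W₁ (ℓ : ℤ)).subtype).codRestrict _ hmem with hr_def
      have hr_inj : Function.Injective r := by
        rw [injective_iff_map_eq_zero]
        intro T hT
        have hT' : f (T : W₁.geomPoints) = 0 := congrArg Subtype.val hT
        have hdisj : Disjoint f.toAddMonoidHom.ker (geomTorsion W₁ (ℓ : ℤ)) := by
          apply AddSubgroup.disjoint_of_coprime_natCard
          rw [hf_card, hℓcard]
          exact (Nat.Coprime.pow_right 2 ((Nat.coprime_primes hp hℓ).mpr (Ne.symm hℓp)))
        have hTmem : (T : W₁.geomPoints) ∈ f.toAddMonoidHom.ker ⊓ geomTorsion W₁ (ℓ : ℤ) :=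
          AddSubgroup.mem_inf.mpr ⟨hT', T.2⟩
        rw [hdisj.eq_bot, AddSubgroup.mem_bot] at hTmem
        exact Subtype.ext hTmem
      haveI : Finite ↥(A ⊓ geomTorsion W (ℓ : ℤ)) := finite_inf_geomTorsion W A hℓ.ne_zero
      have h1 : ℓ ^ 2 ≤ ℓ :=
        calc ℓ ^ 2 = Nat.card (geomTorsion W₁ (ℓ : ℤ)) := hℓcard.symm
          _ ≤ Nat.card ↥(A ⊓ geomTorsion W (ℓ : ℤ)) := Nat.card_le_card_of_injective r hr_inj
          _ ≤ ℓ := natCard_inf_geomTorsion_prime_le W A hℓ hℓK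
            (not_geomTorsion_le_of_isAddCyclic A hℓ hℓK)
      have h2 := hℓ.two_le
      nlinarith
  -- the two kernels differ: otherwise `E[p] ≤ A`
  have hne : ψ₁.toAddMonoidHom.ker ≠ (ψM.comp f).toAddMonoidHom.ker := by
    intro heq
    have hEp : geomTorsion W (p : ℤ) ≤ A := by
      intro P hP
      have h1 : g P ∈ (ψM.comp f).toAddMonoidHom.ker := by
        rw [AddMonoidHom.mem_ker]
        change ψM (f (g P)) = 0
        rw [hfg, AddSubgroup.torsionBy.nsmul_iff.mp hP, map_zero]
      rw [← heq, hψ₁_ker, hC₁_def] at h1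
      obtain ⟨a, ha, hga⟩ := AddSubgroup.mem_map.mp h1
      have hPa : P - a ∈ g.toAddMonoidHom.ker := by
        rw [AddMonoidHom.mem_ker, map_sub, hga, coe_toAddMonoidHom, sub_self]
      have hPa' : P - a ∈ A := hker_g_le hPa
      simpa using A.add_mem hPa' ha
    have h := hAp_card
    rw [inf_eq_right.mpr hEp, natCard_geomTorsion_eq_sq W hpK] at h
    have h2 := hp.two_le
    nlinarith
  exact ⟨W₁, W₂, W₃, hW₁, hW₂, hW₃, g, ψ₁, ψM.comp f, hg_card, hψ₁_cyc, hψ₂_cyc, hψ₁_deg,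
    hψ₂_deg, hne⟩

end Isogeny

end WeierstrassCurve

namespace Literature.NumberTheory.EllipticCurves

open _root_.WeierstrassCurve

/-- **The fact is equivalent to the exclusion of the 84 minimal levels** as degrees of cyclic
`ℚ`-isogenies of elliptic curves over `ℚ` (`→`: `isCyclic_degree_not_mem_minimalLevels_of_kenku`;
`←`: a composite degree outside Kenku's list with all proper divisors in the list is one of the 84,
`mem_minimalLevels_of_minimal`). [cite: Kenku1982, Thm. 1 (proof, list of levels)] -/
theorem kenku_minimalLevels_mem_kenkuDegrees_iff_forall_degree_ne :
    kenku_minimalLevels_mem_kenkuDegrees ↔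
      ∀ (W W' : WeierstrassCurve ℚ) [W.IsElliptic] [W'.IsElliptic] (φ : Isogeny W W'),
        φ.IsCyclic → φ.degree ∉ ({20, 22, 24, 26, 28, 30, 32, 33, 34, 35, 36, 38, 39, 42, 45, 49,
          50, 51, 54, 55, 57, 63, 65, 74, 75, 77, 81, 85, 86, 91, 95, 111, 119, 121, 125, 129, 133,
          134, 143, 169, 185, 187, 201, 209, 215, 221, 247, 259, 289, 301, 323, 326, 335, 361, 407,
          469, 473, 481, 489, 559, 629, 703, 731, 737, 815, 817, 871, 1139, 1141, 1273, 1369, 1591,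
          1793, 1849, 2119, 2479, 2771, 2881, 3097, 4489, 6031, 7009, 10921, 26569} : Finset ℕ) := by
  refine ⟨fun hK W W' _ _ φ hφ ↦ isCyclic_degree_not_mem_minimalLevels_of_kenku hK φ hφ,
    fun h W W' _ _ φ hφ hp hmin ↦ ?_⟩
  by_contra hK
  have h1 : 1 < φ.degree := by
    rcases Nat.lt_or_ge 1 φ.degree with h1 | h1
    · exact h1
    · exact absurd (show φ.degree = 1 by have := φ.degree_pos; omega) fun h ↦ hK (h ▸ by decide)
  exact h W W' φ hφ (mem_minimalLevels_of_minimal h1 hp hK hmin)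

/-- **The ten minimal levels `p²M` from the uniqueness of the rational cyclic `pM`-subgroup**
(Kenku 1982, proof of Thm. 1: case `N' = N`, p. 200, for the levels `121, 289, 361, 1369, 1849,
4489, 26569`, and the end of the Klein–Fricke case, p. 201, for `28 = 2·14`, `45 = 3·15`,
`63 = 3·21`). Over a field `K` of characteristic `0`: if any two cyclic `K`-isogenies of degree
`pM` out of a common elliptic curve over `K` have the same kernel (`hU`; over `ℚ` and for
`pM ∈ {11, 17, 19, 37, 43, 67, 163, 14, 15, 21}` this follows from the fact that the rational
points of `Y₀(pM)` have pairwise distinct `j`-invariants, none of them `0` or `1728` — Kenku,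
p. 200 ("for no distinct values … does the same j-invariant appear"; "Aut(E/NA, A/NA) is ±1 …
unless the j-invariant … is either 0 or 1728 which is not so for any N in the list"), after the
determinations of `X₀(pM)(ℚ)` cited there: Ligozat [8], Ogg [11], Joly for genus one, Mazur [9]
for the primes), then no cyclic `K`-isogeny of an elliptic curve over `K` has degree `p²M`
(`p` prime, `p ∤ M`), by `Isogeny.exists_isCyclic_ker_ne_of_degree_eq_prime_sq_mul`.
[cite: Kenku1982, proof of Thm. 1, pp. 200–201] -/
theorem isCyclic_degree_ne_prime_sq_mul_of_ker_unique {K : Type u} [Field K] [CharZero K]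
    {p M : ℕ} (hp : p.Prime) (hpM : ¬ p ∣ M)
    (hU : ∀ (V V₂ V₃ : WeierstrassCurve K) [V.IsElliptic] [V₂.IsElliptic] [V₃.IsElliptic]
      (ψ₁ : Isogeny V V₂) (ψ₂ : Isogeny V V₃), ψ₁.IsCyclic → ψ₂.IsCyclic →
        ψ₁.degree = p * M → ψ₂.degree = p * M → ψ₁.toAddMonoidHom.ker = ψ₂.toAddMonoidHom.ker)
    {W W' : WeierstrassCurve K} [W.IsElliptic] (φ : Isogeny W W') (hφ : φ.IsCyclic) :
    φ.degree ≠ p ^ 2 * M := fun hdeg ↦ by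
  obtain ⟨W₁, W₂, W₃, hW₁, hW₂, hW₃, -, ψ₁, ψ₂, -, h₁, h₂, hd₁, hd₂, hne⟩ :=
    φ.exists_isCyclic_ker_ne_of_degree_eq_prime_sq_mul hφ hp hpM hdeg
  exact hne (hU W₁ W₂ W₃ ψ₁ ψ₂ h₁ h₂ hd₁ hd₂)

/-- The ten levels of `isCyclic_degree_ne_prime_sq_mul_of_ker_unique` are among the 84 minimal
levels, with the shape `p² M`, `p ∤ M` (finite check). [cite: Kenku1982, proof of Thm. 1, pp. 200–201] -/
theorem kenku_sq_levels :
    ∀ q ∈ ({(11, 1), (17, 1), (19, 1), (37, 1), (43, 1), (67, 1), (163, 1), (2, 7), (3, 5), (3, 7)} :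
        Finset (ℕ × ℕ)),
      q.1.Prime ∧ ¬ q.1 ∣ q.2 ∧ q.1 ^ 2 * q.2 ∈ ({20, 22, 24, 26, 28, 30, 32, 33, 34, 35, 36, 38,
        39, 42, 45, 49, 50, 51, 54, 55, 57, 63, 65, 74, 75, 77, 81, 85, 86, 91, 95, 111, 119, 121,
        125, 129, 133, 134, 143, 169, 185, 187, 201, 209, 215, 221, 247, 259, 289, 301, 323, 326,
        335, 361, 407, 469, 473, 481, 489, 559, 629, 703, 731, 737, 815, 817, 871, 1139, 1141, 1273,
        1369, 1591, 1793, 1849, 2119, 2479, 2771, 2881, 3097, 4489, 6031, 7009, 10921, 26569} :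
          Finset ℕ) := by
  decide +kernel

/-! ### Kenku's case (a): products of two distinct primes of positive genus, from the `j`-tables -/

/-- **The `j`-invariants of the rational isogenies of prime degree `ℓ ∈ {11, 17, 19, 37, 43, 67, 163}`**
(the primes `ℓ` with `genus X₀(ℓ) > 0` for which rational `ℓ`-isogenies exist), as the finite
table of pairs `(ℓ, j)`: `ℓ = 11`: `j = -2¹⁵, -11², -11·131³`; `ℓ = 17`: `-17²·101³/2`,
`-17·373³/2¹⁷`; `ℓ = 19`: `-96³`; `ℓ = 37`: `-7·11³`, `-7·137³·2083³`; `ℓ = 43`: `-960³`;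
`ℓ = 67`: `-5280³`; `ℓ = 163`: `-640320³` (Cremona, *Algorithms for Modular Elliptic Curves*,
2nd ed., §3.8, p. 82; Kenku 1982, p. 200: the `j`-invariants of the rational points of `Y₀(N)`,
`N ∈ {11, 17, 19, 37, 43, 67, 163}`, "integral except for a pair of points on `Y₀(17)(ℚ)` …
`-(17)²(101)³2⁻¹`"). A table of constants (data); that every rational `ℓ`-isogeny has its
`j`-invariant in it is the content of Ligozat 1975, Mazur–Swinnerton-Dyer 1974 and Mazur 1978 and
is NOT asserted here — it enters `isCyclic_degree_ne_mul_of_jTable` as the hypothesis schema `hT`.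
[cite: CremonaAlgorithms1997, §3.8 p. 82] [cite: Kenku1982, proof of Thm. 1, p. 200] -/
def largePrimeIsogenyJTable : Finset (ℕ × ℚ) :=
  {(11, -32768), (11, -121), (11, -24729001), (17, -297756989 / 2), (17, -882216989 / 131072),
    (19, -884736), (37, -9317), (37, -162677523113838677), (43, -884736000),
    (67, -147197952000), (163, -262537412640768000)}

/-- The entries of `largePrimeIsogenyJTable` are the printed values
`-2¹⁵, -11², -11·131³, -17²·101³/2, -17·373³/2¹⁷, -96³, -7·11³, -7·137³·2083³, -960³, -5280³,
-640320³` (arithmetic check). [cite: CremonaAlgorithms1997, §3.8 p. 82] -/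
theorem largePrimeIsogenyJTable_eq :
    largePrimeIsogenyJTable =
      {(11, -2 ^ 15), (11, -11 ^ 2), (11, -11 * 131 ^ 3), (17, -17 ^ 2 * 101 ^ 3 / 2),
        (17, -17 * 373 ^ 3 / 2 ^ 17), (19, -96 ^ 3), (37, -7 * 11 ^ 3), (37, -7 * 137 ^ 3 * 2083 ^ 3),
        (43, -960 ^ 3), (67, -5280 ^ 3), (163, -640320 ^ 3)} := by
  norm_num [largePrimeIsogenyJTable]

/-- In `largePrimeIsogenyJTable` distinct levels have distinct `j`-invariants (finite check): "for
no distinct values `N', N` in the above list does the same `j`-invariant appear" (Kenku 1982,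
p. 200). [cite: Kenku1982, proof of Thm. 1, p. 200] -/
theorem largePrimeIsogenyJTable_fst_eq_of_snd_eq :
    ∀ a ∈ largePrimeIsogenyJTable, ∀ b ∈ largePrimeIsogenyJTable, a.2 = b.2 → a.1 = b.1 := by
  decide +kernel

/-- **Kenku's case (a): two distinct primes of positive genus** (Kenku 1982, proof of Thm. 1,
p. 200: "If the genus of `X₀(N')` is `> 0` and `N' ≠ N`, then this cannot happen because for no
distinct values `N', N` in the above list does the same `j`-invariant appear"). GRANTED the
`j`-tables — hypothesis schema `hT`: an elliptic curve over `ℚ` with a `ℚ`-isogeny of degree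
`ℓ ∈ {11, 17, 19, 37, 43, 67, 163}` has `(ℓ, j) ∈ largePrimeIsogenyJTable` (Ligozat 1975 for
`11, 17, 19`; Mazur–Swinnerton-Dyer 1974 for `37`; Mazur 1978 for `43, 67, 163`; not in the tree) —
no cyclic `ℚ`-isogeny of an elliptic curve over `ℚ` has degree `ℓ₁ℓ₂` for distinct such primes:
it would give `ℚ`-isogenies of degrees `ℓ₁` and `ℓ₂` out of the same curve
(`Isogeny.exists_isCyclic_degree_eq_of_dvd`), whose `j`-invariant would appear twice in the table.
This covers the 21 minimal levels `187, 209, 323, 407, 473, 629, 703, 731, 737, 817, 1139, 1273,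
1591, 1793, 2479, 2771, 2881, 3097, 6031, 7009, 10921`. [cite: Kenku1982, proof of Thm. 1, p. 200] -/
theorem isCyclic_degree_ne_mul_of_jTable
    (hT : ∀ (V V' : WeierstrassCurve ℚ) [V.IsElliptic] [V'.IsElliptic] (ψ : Isogeny V V'),
      ψ.degree ∈ ({11, 17, 19, 37, 43, 67, 163} : Finset ℕ) →
        (ψ.degree, V.j) ∈ largePrimeIsogenyJTable)
    {W W' : WeierstrassCurve ℚ} [W.IsElliptic] (φ : Isogeny W W') (hφ : φ.IsCyclic) {ℓ₁ ℓ₂ : ℕ}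
    (h₁ : ℓ₁ ∈ ({11, 17, 19, 37, 43, 67, 163} : Finset ℕ))
    (h₂ : ℓ₂ ∈ ({11, 17, 19, 37, 43, 67, 163} : Finset ℕ)) (hne : ℓ₁ ≠ ℓ₂) :
    φ.degree ≠ ℓ₁ * ℓ₂ := fun hdeg ↦ by
  obtain ⟨V₁, hV₁, ψ₁, -, hd₁, -⟩ :=
    φ.exists_isCyclic_degree_eq_of_dvd hφ (d := ℓ₁) (hdeg ▸ dvd_mul_right ℓ₁ ℓ₂)
  obtain ⟨V₂, hV₂, ψ₂, -, hd₂, -⟩ :=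
    φ.exists_isCyclic_degree_eq_of_dvd hφ (d := ℓ₂) (hdeg ▸ dvd_mul_left ℓ₂ ℓ₁)
  haveI := hV₁
  haveI := hV₂
  have m₁ := hT W V₁ ψ₁ (hd₁ ▸ h₁)
  have m₂ := hT W V₂ ψ₂ (hd₂ ▸ h₂)
  rw [hd₁] at m₁
  rw [hd₂] at m₂
  exact hne (largePrimeIsogenyJTable_fst_eq_of_snd_eq _ m₁ _ m₂ rfl)

/-- The 21 levels of `isCyclic_degree_ne_mul_of_jTable` (products of two distinct primes among
`11, 17, 19, 37, 43, 67, 163`) are among the 84 minimal levels (finite check).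
[cite: Kenku1982, proof of Thm. 1, p. 200] -/
theorem kenku_two_prime_levels :
    ∀ ℓ₁ ∈ ({11, 17, 19, 37, 43, 67, 163} : Finset ℕ), ∀ ℓ₂ ∈ ({11, 17, 19, 37, 43, 67, 163} : Finset ℕ),
      ℓ₁ ≠ ℓ₂ → ℓ₁ * ℓ₂ ∈ ({20, 22, 24, 26, 28, 30, 32, 33, 34, 35, 36, 38,
        39, 42, 45, 49, 50, 51, 54, 55, 57, 63, 65, 74, 75, 77, 81, 85, 86, 91, 95, 111, 119, 121,
        125, 129, 133, 134, 143, 169, 185, 187, 201, 209, 215, 221, 247, 259, 289, 301, 323, 326,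
        335, 361, 407, 469, 473, 481, 489, 559, 629, 703, 731, 737, 815, 817, 871, 1139, 1141, 1273,
        1369, 1591, 1793, 1849, 2119, 2479, 2771, 2881, 3097, 4489, 6031, 7009, 10921, 26569} :
          Finset ℕ) := by
  decide +kernel

end Literature.NumberTheory.EllipticCurves

end

/-! ## Appended 2026-08-16 (review seat): even the consumed corollary of the fact is Mazur-hard

Review of the named fact `mazurKenku_exists_cyclic_isogeny` (unit `rsplit-…-g3`): could the fact be
RE-CUT to something provable that still serves its dependents? Every in-tree dependent
(`exists_isogeny_degree_le_163`, `masserWustholz_naiveHeight_rat`, the Shimura-curve bound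
`minimalDegree_le_163_mul_of_mazurKenku`, Pasten's Lemma 6.8 "`n ≤ 163`") consumes only the
corollary "two `ℚ`-isogenous elliptic curves over `ℚ` are joined by a `ℚ`-isogeny of degree `≤ 163`".
The theorems below show that this corollary — indeed any uniform bound `B` on minimal isogeny degrees
over `ℚ` — already yields the irreducibility of `E[p]` for EVERY elliptic curve `E/ℚ` and every prime
`p > B`, i.e. Mazur 1978, Thm. 1 at all primes `p > 163`, whose only known proof is Mazur's
(Eisenstein quotient of `J₀(p)`, formal immersion; tree facts `Mazur1978.cor44_valuation_j_le_one`,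
`Mazur1978.prop51_exponent_classes_of_additive`). So no weaker restatement of the fact is cheaper
than Mazur's theorem at the large primes. The argument is Masser–Wüstholz's "isogeny argument"
(Bull. LMS 25 (1993), Lemma 3.1, p. 249 — in the tree for non-CM curves over any field of
characteristic `0` as `MasserWustholz1993.hasIrreducibleModPGaloisRep_of_forall_isogeny_degree_le`),
here over `ℚ` WITHOUT a CM hypothesis, because `End_ℚ(E) = ℤ` for every `E/ℚ`
(`not_hasRationalCM_holds`, used through `exists_degree_mul_degree_eq_sq`): a stable line
`C ⊂ E[p]` is the kernel of the quotient `g : E → E/C` over `ℚ` (degree `p`, cyclic), the bound gives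
`ψ : E → E/C` of degree `b ≤ B`, and `b · p = n²` with `p ∣ n`, so `p ∣ b ≤ B < p`. -/

noncomputable section

namespace Literature.NumberTheory.EllipticCurves

open _root_.WeierstrassCurve

/-- **A uniform bound on isogeny degrees over `ℚ` gives Mazur's theorem at the large primes.** If
any two `ℚ`-isogenous elliptic curves over `ℚ` are joined by a `ℚ`-isogeny of degree `≤ B`, then for
every elliptic curve `E/ℚ` and every prime `p > B` the mod-`p` representation is irreducible (no
rational `p`-isogeny). Masser–Wüstholz's isogeny argument (Lemma 3.1) with `End_ℚ(E) = ℤ` in place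
of "no complex multiplication": a `Γ_ℚ`-stable line `C ⊂ E[p]`
(`Mazur1978.not_hasIrreducibleModPGaloisRep_iff_exists_natCard_eq`) is the kernel of the quotient
`g : E → E' = E/C` over `ℚ` (`exists_isogeny_ker_eq_and_comp_eq_nsmul_holds`, *AEC* III.4.12), a
cyclic isogeny of prime degree `p`; the hypothesis gives `ψ : E → E'` of degree `b ≤ B`; by
`exists_degree_mul_degree_eq_sq`, `b · p = n²` with `p ∣ n`, hence `p² ∣ b p`, `p ∣ b`, `p ≤ b ≤ B`.
[cite: MasserWustholzBLMS1993, §3 Lemma 3.1 (p. 249)] [cite: Mazur1978, Thm 1] -/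
theorem hasIrreducibleModPGaloisRep_of_forall_exists_isogeny_degree_le {B : ℕ}
    (h : ∀ (W W' : WeierstrassCurve ℚ) [W.IsElliptic] [W'.IsElliptic], IsIsogenous W W' →
      ∃ φ : Isogeny W W', φ.degree ≤ B)
    (W : WeierstrassCurve ℚ) [W.IsElliptic] {p : ℕ} (hp : p.Prime) (hBp : B < p) :
    W.HasIrreducibleModPGaloisRep p := by
  haveI : Fact p.Prime := ⟨hp⟩
  haveI : NeZero (p : ℚ) := ⟨Nat.cast_ne_zero.mpr hp.ne_zero⟩
  by_contra hred
  obtain ⟨H, hHstab, hHcard⟩ :=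
    (Mazur1978.not_hasIrreducibleModPGaloisRep_iff_exists_natCard_eq W p).mp hred
  -- the stable line as a finite `Γ_ℚ`-stable subgroup `S` of `E(ℚ̄)` of order `p`
  set S : AddSubgroup W.geomPoints := H.map (geomTorsion W (p : ℤ)).subtype with hS
  have hScard : Nat.card S = p := by
    rw [← hHcard]
    exact Nat.card_congr (H.equivMapOfInjective _ (geomTorsion W (p : ℤ)).subtype_injective).symm
  have hSfin : (S : Set W.geomPoints).Finite :=
    Nat.finite_of_card_ne_zero (hScard ▸ hp.ne_zero)
  have hSstab : ∀ (σ : Field.absoluteGaloisGroup ℚ) (P : W.geomPoints),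
      P ∈ S → σ • P ∈ S := by
    rintro σ P ⟨Q, hQ, rfl⟩
    exact ⟨σ • Q, hHstab σ Q hQ, rfl⟩
  -- the quotient `g : E → E' = E/C` over `ℚ`: cyclic of prime degree `p`
  obtain ⟨W', hW', g, -, hker, -, -⟩ :=
    W.exists_isogeny_ker_eq_and_comp_eq_nsmul_holds S hSfin hSstab
  haveI := hW'
  have hg : g.degree = p := by
    change Nat.card g.toAddMonoidHom.ker = p
    rw [hker, hScard]
  have hgc : g.IsCyclic := isAddCyclic_of_prime_card (p := p) hg
  -- the bound: `ψ : E → E'` of degree `b ≤ B`; but `b · p = n²` with `p ∣ n`, so `p ∣ b`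
  obtain ⟨ψ, hψ⟩ := h W W' ⟨g⟩
  obtain ⟨n, hsq, hdvd⟩ := exists_degree_mul_degree_eq_sq g ψ hgc
  rw [hg] at hsq hdvd
  have hpb : p ∣ ψ.degree := by
    obtain ⟨c, hc⟩ := hdvd
    refine ⟨c ^ 2, Nat.eq_of_mul_eq_mul_right hp.pos ?_⟩
    rw [hsq, hc]
    ring
  exact absurd ((Nat.le_of_dvd ψ.degree_pos hpb).trans hψ) (not_le.mpr hBp)

/-- **The consumed corollary of `mazurKenku_exists_cyclic_isogeny` is already Mazur's theorem at
the primes `p > 163`.** The conclusion of `exists_isogeny_degree_le_163` (two `ℚ`-isogenous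
elliptic curves over `ℚ` are joined by a `ℚ`-isogeny of degree `≤ 163` — the only shape in which
the tree's dependents use the fact) implies that `E[p]` is an irreducible `Γ_ℚ`-module for every
elliptic curve `E/ℚ` and every prime `p > 163` (Mazur 1978, Thm. 1 outside `p ≤ 163`). Hence no
re-cut of the fact to this corollary is easier to discharge than Mazur's theorem at the large
primes. [cite: Mazur1978, Thm 1] [cite: MasserWustholzBLMS1993, §3 Lemma 3.1 (p. 249)] -/
theorem hasIrreducibleModPGaloisRep_of_exists_isogeny_degree_le_163
    (h : ∀ (W W' : WeierstrassCurve ℚ) [W.IsElliptic] [W'.IsElliptic], IsIsogenous W W' →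
      ∃ φ : Isogeny W W', φ.degree ≤ 163)
    (W : WeierstrassCurve ℚ) [W.IsElliptic] {p : ℕ} (hp : p.Prime) (h163 : 163 < p) :
    W.HasIrreducibleModPGaloisRep p :=
  hasIrreducibleModPGaloisRep_of_forall_exists_isogeny_degree_le h W hp h163

/-- In particular the fact itself gives Mazur's theorem at every prime `p > 163` through its
degree-`≤ 163` corollary alone (compare `mazur_isogeny_irreducible_of_mazurKenku`, which uses the
full Kenku list to reach all twelve Mazur primes). [cite: Mazur1978, Thm 1]
[cite: SilvermanAEC2009, IX.6 Example 6.4] -/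
theorem hasIrreducibleModPGaloisRep_of_mazurKenku_of_lt (h : mazurKenku_exists_cyclic_isogeny)
    (W : WeierstrassCurve ℚ) [W.IsElliptic] {p : ℕ} (hp : p.Prime) (h163 : 163 < p) :
    W.HasIrreducibleModPGaloisRep p :=
  hasIrreducibleModPGaloisRep_of_exists_isogeny_degree_le_163
    (fun W W' _ _ hWW' ↦ exists_isogeny_degree_le_163 h W W' hWW') W hp h163

end Literature.NumberTheory.EllipticCurves

end
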